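import Literature.Computability.Cryptography.ShorOrderFindingQuantum
import HarnessLib

/-!
# Boneh–Lipton period finding read out by Kitaev's Hadamard tests, III: decoding a dyadic phase

Topic `Literature/Computability/QuantumComplexity`; third analysis file behind the discharge of
`Literature.Barriers.QuantumAdvantage.aaronsonChen2017_lem75_quantum`. Kitaev's eigenvalue
measurement (Kitaev 1995, §3: cosine and sine Hadamard tests of `U^{2^e}` at every level `e`,
majority per block, then a level-by-level reconstruction, Thm. 1) is specialised to phases that
are EXACT dyadic rationals `u/2^b` — the eigenphases of the shift on `ℤ/2^b`, so that the label `u`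
is recovered exactly:

* the read-out law given `u`: independent tests, control `(e, σ, i)` reading `1` with Kitaev's
  weight `testWeight` at the angle `2π u 2^e/2^b` (`Ctrl`, `angle`, `wt`);
* the decoder `decode` (bits from the least significant end: bit `m` at level `b-1-m`, from the
  block chosen by the octant `code` of the known remainder — the informative test has bias
  `≥ 7/10`, `informative_bias`);
* `decode_eq` — accurate blocks (counts within `B/3` of their means) decode `u`;
  `sum_not_accurate_le` (Chebyshev, `Kitaev1995.chebyshev_block`) and the union bound
  **`sum_decode_ne_le`**: the decoder errs with probability `≤ 9b/4B` for EVERY label `u`.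

## References

* A. Yu. Kitaev, arXiv:quant-ph/9511026 (1995), §3 (Remark 8, the estimate before Lemma 9,
  Lemma 10, Thm. 1) [Kitaev1995].
-/

noncomputable section

namespace Literature.Computability.QuantumComplexity

namespace PeriodFinding

open Finset Real Literature.Computability.Cryptography Literature.Computability.Cryptography.Kitaev1995

/-! ### Trigonometric margins: the informative test has bias at least `7/10` -/

/-- `7/10 ≤ √2/2`. [folklore] -/
theorem seven_div_ten_le_sqrt_two_div_two : (7 / 10 : ℝ) ≤ Real.sqrt 2 / 2 := by
  rw [le_div_iff₀ (by norm_num : (0 : ℝ) < 2), Real.le_sqrt' (by norm_num)]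
  norm_num

/-- On `[0, 1/8]`: `cos 2πr ≥ 7/10`. [folklore] -/
theorem cos_two_pi_mul_ge {r : ℝ} (h0 : 0 ≤ r) (h1 : r ≤ 1 / 8) : 7 / 10 ≤ Real.cos (2 * π * r) := by
  have hle : Real.cos (π / 4) ≤ Real.cos (2 * π * r) :=
    Real.cos_le_cos_of_nonneg_of_le_pi (by positivity)
      (by nlinarith [Real.pi_pos]) (by nlinarith [Real.pi_pos])
  rw [Real.cos_pi_div_four] at hle
  exact seven_div_ten_le_sqrt_two_div_two.trans hle

/-- On `[1/8, 3/8]`: `sin 2πr ≥ 7/10`. [folklore] -/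
theorem sin_two_pi_mul_ge {r : ℝ} (h0 : 1 / 8 ≤ r) (h1 : r ≤ 3 / 8) : 7 / 10 ≤ Real.sin (2 * π * r) := by
  refine seven_div_ten_le_sqrt_two_div_two.trans ?_
  rw [← Real.sin_pi_div_four]
  rcases le_total r (1 / 4) with h | h
  · exact Real.sin_le_sin_of_le_of_le_pi_div_two (by nlinarith [Real.pi_pos])
      (by nlinarith [Real.pi_pos]) (by nlinarith [Real.pi_pos])
  · rw [← Real.sin_pi_sub (2 * π * r)]
    exact Real.sin_le_sin_of_le_of_le_pi_div_two (by nlinarith [Real.pi_pos])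
      (by nlinarith [Real.pi_pos]) (by nlinarith [Real.pi_pos])

/-- On `[3/8, 1/2]`: `cos 2πr ≤ -7/10`. [folklore] -/
theorem cos_two_pi_mul_le {r : ℝ} (h0 : 3 / 8 ≤ r) (h1 : r ≤ 1 / 2) : Real.cos (2 * π * r) ≤ -(7 / 10) := by
  have hle : Real.cos (2 * π * r) ≤ Real.cos (3 * π / 4) :=
    Real.cos_le_cos_of_nonneg_of_le_pi (by positivity)
      (by nlinarith [Real.pi_pos]) (by nlinarith [Real.pi_pos])
  have h34 : Real.cos (3 * π / 4) = -(Real.sqrt 2 / 2) := by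
    rw [show 3 * π / 4 = π - π / 4 by ring, Real.cos_pi_sub, Real.cos_pi_div_four]
  rw [h34] at hle
  linarith [seven_div_ten_le_sqrt_two_div_two]

/-! ### The decision table -/

/-- Which block is informative for the octant code `c = ⌊8r⌋ ∈ {0,1,2,3}` of the known remainder
`r`: the sine tests for `c ∈ {1, 2}` (`2πr` within `π/4` of `π/2`), the cosine tests otherwise. [folklore] -/
def useSin (c : ℕ) : Bool := decide (c = 1 ∨ c = 2)

/-- Whether the informative bias is reversed (`c = 3`: `cos 2πr ≤ -√2/2`). [folklore] -/
def flipAt (c : ℕ) : Bool := decide (c = 3)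

/-- The informative trigonometric value for the octant code `c`. [folklore] -/
def infoVal (c : ℕ) (θ : ℝ) : ℝ := if useSin c then Real.sin θ else Real.cos θ

/-- **The bias of the informative test.** For a remainder `r ∈ [c/8, (c+1)/8)`, `c ≤ 3`, an
integer number of turns `K` and the unknown top bit `t ∈ {0, 1}`, the informative trigonometric
value of the angle `2πK + πt + 2πr` is `≥ 7/10` when `[t = 1] ⊕ flip(c)` is false and `≤ -7/10`
when it is true (Kitaev 1995, §3: the pair (cos, sin) test locates `φ` in a quadrant).
[cite: Kitaev1995, §3 (Remark 8, Lemma 10)] -/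
theorem informative_bias {c : ℕ} {r : ℝ} (hc : c ≤ 3) (hr0 : (c : ℝ) / 8 ≤ r) (hr1 : r < (c + 1) / 8)
    (K : ℤ) (t : ℕ) (ht : t ≤ 1) :
    (xor (decide (t = 1)) (flipAt c) = false → 7 / 10 ≤ infoVal c (2 * π * K + π * t + 2 * π * r)) ∧
      (xor (decide (t = 1)) (flipAt c) = true → infoVal c (2 * π * K + π * t + 2 * π * r) ≤ -(7 / 10)) := by
  -- reduce the angle
  have hcos : Real.cos (2 * π * K + π * t + 2 * π * r) = (if t = 1 then -1 else 1) * Real.cos (2 * π * r) := by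
    have h1 : 2 * π * K + π * t + 2 * π * r = (π * t + 2 * π * r) + K * (2 * π) := by ring
    rw [h1, Real.cos_add_int_mul_two_pi]
    interval_cases t
    · simp
    · simp only [Nat.cast_one, mul_one, if_true]
      rw [add_comm, Real.cos_add_pi]; ring
  have hsin : Real.sin (2 * π * K + π * t + 2 * π * r) = (if t = 1 then -1 else 1) * Real.sin (2 * π * r) := by
    have h1 : 2 * π * K + π * t + 2 * π * r = (π * t + 2 * π * r) + K * (2 * π) := by ring
    rw [h1, Real.sin_add_int_mul_two_pi]
    interval_cases t
    · simp
    · simp only [Nat.cast_one, mul_one, if_true]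
      rw [add_comm, Real.sin_add_pi]; ring
  unfold infoVal
  rw [hcos, hsin]
  interval_cases c
  · -- c = 0: cosine, no flip; r ∈ [0, 1/8)
    have hb := cos_two_pi_mul_ge (r := r) (by simpa using hr0) (by norm_num at hr1; linarith)
    interval_cases t <;> simp [useSin, flipAt] <;> linarith
  · -- c = 1: sine; r ∈ [1/8, 1/4)
    have hb := sin_two_pi_mul_ge (r := r) (by norm_num at hr0; linarith) (by norm_num at hr1; linarith)
    interval_cases t <;> simp [useSin, flipAt] <;> linarith
  · -- c = 2: sine; r ∈ [1/4, 3/8)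
    have hb := sin_two_pi_mul_ge (r := r) (by norm_num at hr0; linarith) (by norm_num at hr1; linarith)
    interval_cases t <;> simp [useSin, flipAt] <;> linarith
  · -- c = 3: cosine, flipped; r ∈ [3/8, 1/2)
    have hb := cos_two_pi_mul_le (r := r) (by norm_num at hr0; linarith) (by norm_num at hr1; linarith)
    interval_cases t <;> simp [useSin, flipAt] <;> linarith

/-! ### Kitaev's test weights (`Kitaev1995.testWeight_nonneg`, `Kitaev1995.testWeight_false_add_true`) -/

/-- The weight of outcome `1` is `(1 - v)/2`, `v` the tested trigonometric value. [cite: Kitaev1995, §3 Remark 8] -/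
theorem testWeight_true (σ : Bool) (θ : ℝ) :
    testWeight true σ θ = (1 - (if σ then Real.sin θ else Real.cos θ)) / 2 := by
  cases σ <;> simp [testWeight] <;> ring

/-! ### The controls of one period-finding block and their read-out law -/

variable {b B : ℕ}

/-- The controls of one block: level `e < b`, test type (`true` = sine test) and repetition
index `< B`. [cite: Kitaev1995, §3 (Lemma 10: all powers, several tests each)] -/
abbrev Ctrl (b B : ℕ) : Type := Fin b × Bool × Fin B

/-- The test angle `2π u 2^e / 2^b` of level `e` at the Fourier label `u`. [cite: Kitaev1995, §3 (Lemma 10)] -/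
def angle (b u e : ℕ) : ℝ := 2 * π * u * 2 ^ e / 2 ^ b

/-- The read-out law of the controls given the label `u`: independent tests with Kitaev's
weights. [cite: Kitaev1995, §3 (Remark 8, Lemma 8)] -/
def wt (b B u : ℕ) (j : Ctrl b B) (c : Bool) : ℝ := testWeight c j.2.1 (angle b u j.1)

/-- Weights are nonnegative. [folklore] -/
theorem wt_nonneg (u : ℕ) (j : Ctrl b B) (c : Bool) : 0 ≤ wt b B u j c := Kitaev1995.testWeight_nonneg _ _ _

/-- Weights of the two outcomes sum to `1`. [folklore] -/
theorem wt_false_add_true (u : ℕ) (j : Ctrl b B) : wt b B u j false + wt b B u j true = 1 :=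
  Kitaev1995.testWeight_false_add_true _ _

/-- The block of the `B` tests of level `e` and type `σ`. [folklore] -/
def blk (e : Fin b) (σ : Bool) : Finset (Ctrl b B) := {e} ×ˢ ({σ} ×ˢ univ)

/-- Membership in a block. [folklore] -/
theorem mem_blk {e : Fin b} {σ : Bool} {j : Ctrl b B} : j ∈ blk e σ ↔ j.1 = e ∧ j.2.1 = σ := by
  obtain ⟨e', σ', i⟩ := j
  simp only [blk, mem_product, mem_singleton, mem_univ, and_true]

/-- A block has `B` tests. [folklore] -/
theorem card_blk (e : Fin b) (σ : Bool) : (blk e σ : Finset (Ctrl b B)).card = B := by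
  simp [blk]

/-- The expected number of `1`s in a block. [folklore] -/
theorem sum_blk_wt_true (u : ℕ) (e : Fin b) (σ : Bool) :
    ∑ j ∈ (blk e σ : Finset (Ctrl b B)), wt b B u j true = B * testWeight true σ (angle b u e) := by
  have h : ∀ j ∈ (blk e σ : Finset (Ctrl b B)), wt b B u j true = testWeight true σ (angle b u e) := by
    intro j hj
    obtain ⟨h1, h2⟩ := mem_blk.1 hj
    rw [wt, h1, h2]
  rw [sum_congr rfl h, sum_const, card_blk, nsmul_eq_mul]

/-- The number of `1`s read in a block. [folklore] -/
def cnt (γ : Ctrl b B → Bool) (e : Fin b) (σ : Bool) : ℕ :=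
  ((blk e σ : Finset (Ctrl b B)).filter fun j => γ j = true).card

/-! ### The decoder -/

/-- The octant code `⌊8r⌋ = ⌊4v/2^m⌋` of the remainder `r = v/2^{m+1}` given by the `m` known low
bits `v`. [folklore] -/
def code (v m : ℕ) : ℕ := 4 * v / 2 ^ m

/-- **The decoder** (bit by bit from the least significant end): having decoded the `m` low bits
`v`, the bit `m` is read at level `b - 1 - m`, whose angle is `π u_m + 2π v/2^{m+1}` modulo `2π`,
from the majority of the informative block (chosen by the octant of `v/2^{m+1}`), reversed when
the octant code is `3`. `dec γ m` is the value of the `m` decoded low bits.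
[cite: Kitaev1995, §3 (Lemma 10, Thm. 1: refinement level by level)] -/
def dec (γ : Ctrl b B → Bool) : ℕ → ℕ
  | 0 => 0
  | m + 1 =>
    if h : m < b then
      dec γ m + 2 ^ m *
        (xor (decide (B < 2 * cnt γ ⟨b - 1 - m, by omega⟩ (useSin (code (dec γ m) m))))
          (flipAt (code (dec γ m) m))).toNat
    else dec γ m

/-- The decoded label. [cite: Kitaev1995, §3 Thm. 1] -/
def decode (γ : Ctrl b B → Bool) : ℕ := dec γ b

/-! ### Accurate blocks decode correctly -/

/-- The block read at step `m` (for the true label `u`) is *accurate*: its count of `1`s is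
within `B/3` of its mean. [cite: Kitaev1995, §3 (before Lemma 9)] -/
def Accurate (u m : ℕ) (hm : m < b) (γ : Ctrl b B → Bool) : Prop :=
  |(cnt γ ⟨b - 1 - m, by omega⟩ (useSin (code (u % 2 ^ m) m)) : ℝ) -
      ∑ j ∈ (blk ⟨b - 1 - m, by omega⟩ (useSin (code (u % 2 ^ m) m)) : Finset (Ctrl b B)),
        wt b B u j true| < B / 3

/-- The octant code is at most `3`. [folklore] -/
theorem code_le {v m : ℕ} (hv : v < 2 ^ m) : code v m ≤ 3 := by
  unfold code
  rw [Nat.div_le_iff_le_mul_add_pred (Nat.two_pow_pos m)]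
  have := Nat.two_pow_pos m
  omega

/-- The octant code brackets the remainder: `c/8 ≤ v/2^{m+1} < (c+1)/8`. [folklore] -/
theorem code_div_le_and_lt (v m : ℕ) :
    (code v m : ℝ) / 8 ≤ v / 2 ^ (m + 1) ∧ (v : ℝ) / 2 ^ (m + 1) < (code v m + 1) / 8 := by
  have hpos : 0 < 2 ^ m := Nat.two_pow_pos m
  have h1 : code v m * 2 ^ m ≤ 4 * v := Nat.div_mul_le_self _ _
  have h2 : 4 * v < code v m * 2 ^ m + 2 ^ m := Nat.lt_div_mul_add hpos
  have h1' : (code v m : ℝ) * 2 ^ m ≤ 4 * v := by exact_mod_cast h1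
  have h2' : (4 * v : ℝ) < code v m * 2 ^ m + 2 ^ m := by exact_mod_cast h2
  have hp : (0 : ℝ) < 2 ^ m := by positivity
  rw [pow_succ]
  constructor
  · rw [div_le_div_iff₀ (by norm_num) (by positivity)]; nlinarith
  · rw [div_lt_div_iff₀ (by positivity) (by norm_num)]; nlinarith

/-- **The angle of level `b-1-m` splits** as `2πK + π t + 2π r` with `K = ⌊u/2^{m+1}⌋` turns,
the bit `t = u_m` and the remainder `r = (u mod 2^m)/2^{m+1}`. [cite: Kitaev1995, §3 (Lemma 10)] -/
theorem angle_split {u m : ℕ} (hm : m < b) :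
    angle b u (b - 1 - m) = 2 * π * ((u / 2 ^ (m + 1) : ℕ) : ℝ) + π * ((u / 2 ^ m % 2 : ℕ) : ℝ) +
      2 * π * (((u % 2 ^ m : ℕ) : ℝ) / 2 ^ (m + 1)) := by
  have hu : u = 2 ^ (m + 1) * (u / 2 ^ (m + 1)) + (u % 2 ^ m + 2 ^ m * (u / 2 ^ m % 2)) := by
    rw [← Nat.mod_pow_succ, Nat.div_add_mod]
  have hu' : (u : ℝ) = 2 ^ (m + 1) * ((u / 2 ^ (m + 1) : ℕ) : ℝ) +
      (((u % 2 ^ m : ℕ) : ℝ) + 2 ^ m * ((u / 2 ^ m % 2 : ℕ) : ℝ)) := by exact_mod_cast hu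
  have hb : (2 : ℝ) ^ b = 2 ^ (b - 1 - m) * 2 ^ (m + 1) := by
    rw [← pow_add]; congr 1; omega
  unfold angle
  rw [hb, hu']
  field_simp
  ring

/-- **An accurate block decodes its bit.** [cite: Kitaev1995, §3 (Lemma 10, Thm. 1)] -/
theorem dec_succ_eq {u m : ℕ} (hm : m < b) (γ : Ctrl b B → Bool) (hacc : Accurate u m hm γ)
    (ih : dec γ m = u % 2 ^ m) : dec γ (m + 1) = u % 2 ^ (m + 1) := by
  set v := u % 2 ^ m with hv
  set c := code v m with hc
  set t := u / 2 ^ m % 2 with ht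
  set e : Fin b := ⟨b - 1 - m, by omega⟩ with he
  have hvlt : v < 2 ^ m := Nat.mod_lt _ (Nat.two_pow_pos m)
  have htle : t ≤ 1 := by omega
  -- the informative bias
  obtain ⟨hr0, hr1⟩ := code_div_le_and_lt v m
  have hbias := informative_bias (code_le hvlt) hr0 hr1 ((u / 2 ^ (m + 1) : ℕ) : ℤ) t htle
  rw [Int.cast_natCast, ← angle_split hm] at hbias
  -- the mean of the informative block
  have hmean : ∑ j ∈ (blk e (useSin c) : Finset (Ctrl b B)), wt b B u j true =
      B * ((1 - infoVal c (angle b u (b - 1 - m))) / 2) := by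
    rw [sum_blk_wt_true, testWeight_true, infoVal]
  have hacc' : |(cnt γ e (useSin c) : ℝ) - B * ((1 - infoVal c (angle b u (b - 1 - m))) / 2)| < B / 3 := by
    have := hacc; unfold Accurate at this; rwa [hmean] at this
  -- the decision is the true bit xor the flip
  have hdec : xor (decide (B < 2 * cnt γ e (useSin c))) (flipAt c) = decide (t = 1) := by
    have hB0 : (0 : ℝ) ≤ B := Nat.cast_nonneg B
    cases hd : xor (decide (t = 1)) (flipAt c)
    · have h7 := hbias.1 hd
      have hlt : ¬ (B < 2 * cnt γ e (useSin c)) := by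
        intro h
        have h' : (B : ℝ) < 2 * cnt γ e (useSin c) := by exact_mod_cast h
        have := (abs_lt.1 hacc').2
        nlinarith
      rw [decide_eq_false hlt]
      revert hd; cases decide (t = 1) <;> cases flipAt c <;> simp
    · have h7 := hbias.2 hd
      have hlt : B < 2 * cnt γ e (useSin c) := by
        have := (abs_lt.1 hacc').1
        have h' : (B : ℝ) < 2 * cnt γ e (useSin c) := by nlinarith
        exact_mod_cast h'
      rw [decide_eq_true hlt]
      revert hd; cases decide (t = 1) <;> cases flipAt c <;> simp
  -- assemble
  have hstep : dec γ (m + 1) = dec γ m + 2 ^ m *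
      (xor (decide (B < 2 * cnt γ e (useSin (code (dec γ m) m)))) (flipAt (code (dec γ m) m))).toNat := by
    simp only [dec, dif_pos hm]
    rfl
  rw [hstep, ih, ← hc, hdec, Nat.mod_pow_succ, ← hv, ← ht]
  congr 2
  interval_cases t <;> simp

/-- Below `b`, if every block is accurate the low bits are decoded correctly. [cite: Kitaev1995, §3 Thm. 1] -/
theorem dec_eq_mod (u : ℕ) (γ : Ctrl b B → Bool) (hacc : ∀ (m : ℕ) (hm : m < b), Accurate u m hm γ) :
    ∀ m, m ≤ b → dec γ m = u % 2 ^ m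
  | 0, _ => by rw [pow_zero, Nat.mod_one]; rfl
  | m + 1, h => dec_succ_eq (by omega) γ (hacc m (by omega)) (dec_eq_mod u γ hacc m (by omega))

/-- **Accurate read-outs decode the label**: `decode γ = u` for `u < 2^b`. [cite: Kitaev1995, §3 Thm. 1] -/
theorem decode_eq (u : ℕ) (hu : u < 2 ^ b) (γ : Ctrl b B → Bool)
    (hacc : ∀ (m : ℕ) (hm : m < b), Accurate u m hm γ) : decode γ = u := by
  rw [decode, dec_eq_mod u γ hacc b le_rfl, Nat.mod_eq_of_lt hu]

/-! ### The probability of decoding: Chebyshev per level and a union bound -/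

open Classical in
/-- **An inaccurate block is unlikely** (Chebyshev, `Kitaev1995.chebyshev_block`): under the
read-out law of the label `u`, the block read at step `m` deviates from its mean by `B/3` or
more with probability at most `9/4B`. [cite: Kitaev1995, §3 (before Lemma 9)] -/
theorem sum_not_accurate_le (hB : 0 < B) (u m : ℕ) (hm : m < b) :
    ∑ γ ∈ univ.filter (fun γ : Ctrl b B → Bool => ¬ Accurate u m hm γ), ∏ j, wt b B u j (γ j) ≤
      9 / (4 * B) := by
  classical
  have hB' : (0 : ℝ) < B := by exact_mod_cast hB
  have h := chebyshev_block (wt b B u) (fun j c => wt_nonneg u j c) (wt_false_add_true u)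
    (blk ⟨b - 1 - m, by omega⟩ (useSin (code (u % 2 ^ m) m)) : Finset (Ctrl b B)) (a := (B : ℝ) / 3)
    (by positivity)
  rw [card_blk] at h
  have hval : (B : ℝ) / (4 * ((B : ℝ) / 3) ^ 2) = 9 / (4 * B) := by
    field_simp
    norm_num
  rw [hval] at h
  refine le_trans (le_of_eq (sum_congr ?_ fun _ _ => rfl)) h
  refine filter_congr fun γ _ => ?_
  unfold Accurate cnt
  exact not_lt

/-- Accuracy at step `m`, as a total predicate (true beyond `b`). [folklore] -/
def AccurateD (u m : ℕ) (γ : Ctrl b B → Bool) : Prop := ∀ hm : m < b, Accurate u m hm γ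

/-- Sums of nonnegative terms over a finite union of exceptional sets (union bound). [folklore] -/
theorem sum_filter_exists_lt_le {ι : Type*} [Fintype ι] (f : ι → ℝ) (hf : ∀ i, 0 ≤ f i)
    (P : ℕ → ι → Prop) [∀ m i, Decidable (P m i)] :
    ∀ k : ℕ, ∑ i ∈ univ.filter (fun i => ∃ m < k, P m i), f i ≤
      ∑ m ∈ range k, ∑ i ∈ univ.filter (P m), f i
  | 0 => by simp
  | k + 1 => by
    classical
    have hsplit : univ.filter (fun i => ∃ m < k + 1, P m i) =
        univ.filter (fun i => ∃ m < k, P m i) ∪ univ.filter (P k) := by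
      rw [← filter_or]
      refine filter_congr fun i _ => ⟨?_, ?_⟩
      · rintro ⟨m, hm, hP⟩
        rcases Nat.lt_succ_iff_lt_or_eq.1 hm with h | rfl
        · exact Or.inl ⟨m, h, hP⟩
        · exact Or.inr hP
      · rintro (⟨m, hm, hP⟩ | hP)
        · exact ⟨m, Nat.lt_succ_of_lt hm, hP⟩
        · exact ⟨k, Nat.lt_succ_self k, hP⟩
    rw [hsplit, sum_range_succ]
    have hu := sum_union_inter (s₁ := univ.filter (fun i => ∃ m < k, P m i)) (s₂ := univ.filter (P k)) (f := f)
    have hnn : 0 ≤ ∑ i ∈ univ.filter (fun i => ∃ m < k, P m i) ∩ univ.filter (P k), f i :=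
      sum_nonneg fun i _ => hf i
    have ih := sum_filter_exists_lt_le f hf P k
    linarith

/-- **Kitaev's estimate for a dyadic phase.** Under the read-out law of a label `u < 2^b` (levels
`0, …, b-1`, `B` cosine and `B` sine tests per level), the decoder returns `u` except with
probability at most `9b/4B` (one Chebyshev bound per level, `sum_not_accurate_le`, and
`decode_eq`). [cite: Kitaev1995, §3 (Thm. 1 with the estimate before Lemma 9)] -/
theorem sum_decode_ne_le (hB : 0 < B) (u : ℕ) (hu : u < 2 ^ b) :
    ∑ γ ∈ univ.filter (fun γ : Ctrl b B → Bool => decode γ ≠ u), ∏ j, wt b B u j (γ j) ≤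
      b * (9 / (4 * B)) := by
  classical
  have hnn : ∀ γ : Ctrl b B → Bool, 0 ≤ ∏ j, wt b B u j (γ j) := fun γ => prod_nonneg fun j _ => wt_nonneg u j _
  -- a wrong decoding has an inaccurate block
  have hsub : univ.filter (fun γ : Ctrl b B → Bool => decode γ ≠ u) ⊆
      univ.filter (fun γ => ∃ m < b, ¬ AccurateD u m γ) := by
    intro γ hγ
    rw [mem_filter] at hγ ⊢
    refine ⟨mem_univ _, ?_⟩
    by_contra h
    push Not at h
    exact hγ.2 (decode_eq u hu γ fun m hm => h m hm hm)
  refine (sum_le_sum_of_subset_of_nonneg hsub fun γ _ _ => hnn γ).trans ?_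
  refine (sum_filter_exists_lt_le _ hnn (fun m γ => ¬ AccurateD u m γ) b).trans ?_
  calc ∑ m ∈ range b, ∑ γ ∈ univ.filter (fun γ : Ctrl b B → Bool => ¬ AccurateD u m γ), ∏ j, wt b B u j (γ j)
      ≤ ∑ _m ∈ range b, (9 : ℝ) / (4 * B) := by
        refine sum_le_sum fun m hm => ?_
        have hmb : m < b := mem_range.1 hm
        refine le_trans (le_of_eq (sum_congr (filter_congr fun γ _ => ?_) fun _ _ => rfl))
          (sum_not_accurate_le hB u m hmb)
        unfold AccurateD
        exact ⟨fun h hacc => h fun _ => hacc, fun h hacc => h (hacc hmb)⟩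
    _ = b * (9 / (4 * B)) := by rw [sum_const, card_range, nsmul_eq_mul]

/-- The read-out law is a probability distribution. [folklore] -/
theorem sum_prod_wt (u : ℕ) : ∑ γ : Ctrl b B → Bool, ∏ j, wt b B u j (γ j) = 1 :=
  sum_prodWeight (wt b B u) (wt_false_add_true u)

/-- **Correct decoding with probability at least `1 - 9b/4B`.** [cite: Kitaev1995, §3 Thm. 1] -/
theorem sum_decode_eq_ge (hB : 0 < B) (u : ℕ) (hu : u < 2 ^ b) :
    1 - b * (9 / (4 * B)) ≤
      ∑ γ ∈ univ.filter (fun γ : Ctrl b B → Bool => decode γ = u), ∏ j, wt b B u j (γ j) := by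
  classical
  have h1 := sum_decode_ne_le hB u hu
  have h2 : ∑ γ ∈ univ.filter (fun γ : Ctrl b B → Bool => decode γ = u), ∏ j, wt b B u j (γ j) +
      ∑ γ ∈ univ.filter (fun γ : Ctrl b B → Bool => decode γ ≠ u), ∏ j, wt b B u j (γ j) = 1 := by
    rw [← sum_prod_wt (b := b) (B := B) u,
      ← sum_filter_add_sum_filter_not univ (fun γ : Ctrl b B → Bool => decode γ = u)]
  linarith

end PeriodFinding

end Literature.Computability.QuantumComplexity

end
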